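import Summits.HodgeConjecture.HodgeConjecture.Theorems.Ring2TransportWeilTypeGeneral
import Summits.HodgeConjecture.HodgeConjecture.Theorems.Ring2TransportWeilClasses
import Literature.AlgebraicGeometry.VanGeemen1994.WeilDiscriminantClass
import HarnessLib

/-!
# Ring 2 — hypotheses layer, part VII-A: Weil class targets and transport inputs indexed by `(K = ℚ(√-d), 2n, δ = det H)`

HONEST FRAMING: research route conditional on HC_CM; not a corollary; Q11.4-sentence-2 already refuted in dim ≥ 3.

Cell `pub-hodge-ring2`, seat `pub-hodge-ring2-typer2`, gen 5. `HC_CM` is ALWAYS the binder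
`(hCM : Theses.RankFourFaces.CMAbelianHodge)` (stmt-HodgeConjecture-3052), never an axiom, never cited as known.
Nothing here proves a case of the Hodge conjecture: every theorem is an implication between NAMED typed statements;
sorry-free; axioms `propext`, `Classical.choice`, `Quot.sound`. Companion: part VII-B `Ring2HypothesesWeilComponentsLadder`
(on-path lemmas, exactness versus rung R∞, split components = rungs R2 / R1′, known cells of the δ-table, T6).

## What this file types (OUTLINE §2, the row "fixed `K`, fixed `2n`, discriminant class → `HC_Weil_K_2n_disc_of_HC_CM`")

The habitat tables of the cell index the Weil-type components by the three discrete invariants of a polarized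
abelian variety of Weil type `(X, K, E)`, `K = ℚ(√-d)`: `dim X = 2n`, `K`, and the discriminant class
`det H ∈ ℚ^×/Nm(K^×)` of the Hermitian form `H = E(x, √-d y) + √-d E(x, y)` (van Geemen, LNM 1594, 4.14 and
Lemma 5.2 (2)–(3); Markman, arXiv:2502.03415 §1.1). The Literature seat typed the invariant on the real carriers as
`VanGeemen1994.HasWeilDiscriminantNondeg A φ n d h δ` (`δ : weilNormResidueGroup d = ℚˣ ⧸ Nm(K_dˣ)`; the
NON-DEGENERATE form — cell referee advisory F12: the plain `HasWeilDiscriminant` holds at `(h, δ) = (0, 1)` through a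
junk value and must not index a class target). This file is its first consumer:

* `WeilClassesComponent n d δ` — CLASS TARGET of the component: for `(A, φ)` an abelian `2n`-fold with
  `φ ≫ φ = -d`, polarized by a `K`-symmetrised hyperplane class `h = d·e^*a + φ^*e^*a` with `det H = δ`
  (non-degenerate witness), every rational `(n,n)` class of the Weil plane `weilClassesOf A φ n d` is algebraic —
  LITERALLY the floor fact `Markman2025_weilClasses_algebraic_hyperbolicSixfold` / rung R2 with
  `IsHyperbolicWeilType A φ n h` replaced by `HasWeilDiscriminantNondeg A φ n d h δ`. ON-PATH (part VII-B).
* `WeilVariationalHodgeComponent n d δ` — "VHC_instance ⟨Weil, ℚ(√-d), 2n, δ⟩": rung R∞var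
  (`WeilTypeLadder.WeilVariationalHodgeQuadratic`) RESTRICTED to families all of whose fibres carry Weil charts of
  type `(n, d)` polarized with discriminant `δ` (`HasWeilChartsOfDisc`). ON-PATH; weaker than R∞var (part VII-B).
* `PointedWeilFamiliesComponent n d δ anchor` — the family-supply leaf of the component with an ABSTRACT anchor
  predicate at the marked fibre, and its three instances `CMPointedWeilFamiliesComponent` (a CM chart: the `HC_CM`
  row), `AnchoredWeilFamiliesComponent` (an algebraic restriction: R∞anc of the component; a case of HC) and
  `DivisorGeneratedCMPointedWeilFamiliesComponent` (a CM chart whose rational `(n,n)` classes are polynomials in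
  divisors: the `HC_CM`-FREE row, cf. `Ring2Transport.DivisorGeneratedCMPointedWeilFamiliesQuadratic`).

## Rows (kernel-checked; `h := d·e^*a + φ^*e^*a` throughout)

| row | theorem | inputs | honest column |
|---|---|---|---|
| W1 | `weilClassesComponent_of_HC_CM` | `HC_CM`, `CMPointedWeilFamiliesComponent n d δ`, `WeilVariationalHodgeComponent n d δ` | `HC_CM` NOMINAL (`K` imaginary quadratic is anchor-good: RING2-MAP §transport (vi-b)(c1)); content = the δ-restricted transport leaf, VHC strength, OPEN |
| W1′ | `weilClassesComponent_of_divisorGeneratedCMPointed` | `DivisorGeneratedCMPointedWeilFamiliesComponent n d δ`, `WeilVariationalHodgeComponent n d δ` | the same row WITHOUT `HC_CM` (Lefschetz (1,1) + products at the diagonal CM member) |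
| W1″ | `weilClassesComponent_of_anchored_of_variational` | `AnchoredWeilFamiliesComponent`, `WeilVariationalHodgeComponent` | R∞anc(δ) ∧ R∞var(δ) ⟹ W(δ) (Markman's strategy per component) |
| — | `anchoredWeilFamiliesComponent_of_hodgeConjecture`, `…_of_HC_CM_of_cmPointed`, `cmPointedWeilFamiliesComponent_of_divisorGenerated` | HC resp. `HC_CM` resp. nothing | bookkeeping between the three family leaves |

PRINT STATUS (RING2-MAP §transport (vii), FRESHNESS.md): the class target is OPEN for every `n ≥ 4` and every
`(d, δ)`, and for the non-split sixfold components `(3, d, δ ≠ -1)`; the known cells are listed in part VII-B. WHAT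
THE KERNEL ROWS ADD about Hodge classes: NOTHING — they are implications; the open input of every component is its
δ-restricted Weil-confined variational Hodge statement (or a CM-germ / strict-semiregularity substitute,
`Ring2Transport.LocalWeilVHCAtCMQuadratic`, `Ring2Transport.SemiregularLiftAtCMPoints`), and the CM-pointed family
leaf (met in print by the Weil–Deligne–Mumford moduli families but kept typed).

ANTI-VACUITY: no theorem of the tree exhibits a witness of `HasWeilDiscriminantNondeg` (the Literature file proves only
its failure at `h = 0`); that every Weil-type pair carrying a non-zero rational `(n,n)` Weil class is polarized with
SOME non-degenerate `δ` is the typed print hypothesis `PolarizedWeilDiscriminantExists` of part VII-B (Lemma 5.2),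
under which the components jointly carry the full content of R∞ — whose own anti-vacuity is the Literature theorem
`HodgeTheory.exists_isHyperbolicWeilType_with_weilClass`. EMPTY COMPONENTS: in print `H` has signature `(n, n)`
(Lemma 5.2 (4)), so the components with `(-1)ⁿ·δ < 0` contain no polarized triple and their targets are vacuous; the
carriers do not know this (no signature theorem in the tree) and nothing here uses it.

NOT CLAIMED, NOT TYPED: (i) that `det H` is independent of the polarization for a fixed `(A, φ)` — it is not
(a diagonal member `Bⁿ × Bⁿ` carries product polarizations of every admissible discriminant), which is why every
statement quantifies over the polarizing pair `(e, a)`; (ii) the CM-field (`[K:ℚ] ≥ 4`) analogue, whose discriminant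
lives in `K₀^×/Nm(K^×)` and has no carrier in the tree; (iii) any δ-version of the CM-germ leaf.

## References

* [vanGeemen1994HodgeAV] B. van Geemen, LNM 1594 (1994): 4.14, Lemma 5.2 (1)–(4), 5.3–5.5, (5.4.1), Thm. 6.12.
* [Markman2025SecantWeil] E. Markman, arXiv:2502.03415 (UNREFEREED), §1.1 (invariants `(n, K, det H)`), Thm. 1.5.1.
* [Deligne1982HodgeCycles] §4–5. [Mumford1969NoteShimura] §3. [CharlesSchnell2014Notes] 11.3.1. [Milne1999] §7. [Weil1977HodgeRing].
-/

set_option linter.dupNamespace false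

noncomputable section

open CategoryTheory
open Literature.AlgebraicGeometry Literature.AlgebraicGeometry.Motives
open Literature.AlgebraicGeometry.HodgeTheory
open Literature.AlgebraicTopology.SingularHomology
open Literature.AlgebraicGeometry.Milne1999 (IsOfCMType)
open Literature.AlgebraicGeometry.VanGeemen1994
open Literature.Barriers.HodgeConjecture (divisorClassesSpan)
open Summit.HodgeConjecture.HodgeConjecture.WeilTypeLadder
open Summit.HodgeConjecture.HodgeConjecture.Theses
open Summit.HodgeConjecture.HodgeConjecture.Theorems (isSmoothProjectiveFamily_toSpecOver' isIso_fiberι_toSpecOver')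
open Summit.HodgeConjecture.HodgeConjecture.Ring2Transport

namespace Summit.HodgeConjecture.HodgeConjecture.Ring2.Hypotheses

/-! ### §1 The discriminant-indexed class target and its transport inputs -/

/-- **`WeilClassesComponent n d δ` — CLASS TARGET of the Weil-type component `(K = ℚ(√-d), 2n, δ)` (typed; a CASE of
the summit).** For `A` a smooth projective complex abelian variety of dimension `2n` with `φ ≫ φ = -(d • 𝟙 A)`, a
projective embedding `e` and a rational `a ≠ 0` in `H²(ℙᴺ(ℂ); ℂ)` such that the `K`-symmetrised hyperplane class
`h = d·e^*a + φ^*e^*a` has NON-DEGENERATE discriminant class `det H = δ` (`VanGeemen1994.HasWeilDiscriminantNondeg`,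
Lemma 5.2 (2)–(3)), every rational `(n,n)` class of `weilClassesOf A φ n d` is algebraic. The `(n, d)`-slice of rung
R∞ `WeilTypeLadder.WeilClassesImaginaryQuadratic` cut down to ONE value of the third invariant; literally the floor fact
`Markman2025_weilClasses_algebraic_hyperbolicSixfold` / rung R2 with "hyperbolic" replaced by "`det H = δ`". Known cells:
part VII-B (W5); OPEN otherwise. ON-PATH: `weilClassesComponent_of_hodgeConjecture` (part VII-B). EMPTY COMPONENTS: in print `H` has
signature `(n, n)` (Lemma 5.2 (4)), so `sign (det H) = (-1)ⁿ` and the components with `(-1)ⁿ·δ < 0` contain no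
polarized triple — there the target is vacuous (4.14: "for any `x ∈ ℚ^*/Nm(K^*)` with `(-1)ⁿ x > 0` … a family … with
`det H = x`"); the carriers do not know this (no signature theorem in the tree), and nothing below uses it.
[cite: vanGeemen1994HodgeAV, 4.14, Lemma 5.2 (2)–(3) and 5.3–5.5] [cite: Markman2025SecantWeil, §1.1 (preprint, unrefereed)]
[cite: Weil1977HodgeRing] [status: open] -/
@[conjecture] def WeilClassesComponent (n d : ℕ) (δ : weilNormResidueGroup d) : Prop :=
  ∀ (A : AbelianVariety ℂ) (φ : A ⟶ A), A.dim = 2 * n → IsSmoothProjective (2 * n) A.X → φ ≫ φ = -(d • 𝟙 A) →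
    ∀ (e : ProjectiveEmbedding A.X) (a : complexBetti (projectiveSpace e.n ℂ) 2), IsRationalClass a → a ≠ 0 →
      HasWeilDiscriminantNondeg A φ n d
        ((d : ℂ) • complexBetti.map e.ι 2 a + complexBetti.map φ.hom.hom.hom 2 (complexBetti.map e.ι 2 a)) δ →
      ∀ c : complexBetti A.X (2 * n), IsRationalClass c → IsOfHodgeType (2 * n) A.X (2 * n) n n c →
        c ∈ weilClassesOf A φ n d → c ∈ algebraicClasses A.X n

/-- **`WeilClassesByComponent` — every component, every `n ≥ 2`, every `d ≥ 1`, every `δ`.** Implied by R∞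
(`weilClassesByComponent_of_weilClassesImaginaryQuadratic`) and EQUIVALENT to it granted van Geemen's Lemma 5.2
(`weilClassesImaginaryQuadratic_iff_byComponent`), both in part VII-B. [cite: vanGeemen1994HodgeAV, Lemma 5.2] [status: open] -/
@[conjecture] def WeilClassesByComponent : Prop :=
  ∀ (n : ℕ), 2 ≤ n → ∀ (d : ℕ), 0 < d → ∀ δ : weilNormResidueGroup d, WeilClassesComponent n d δ

/-- **`HasWeilChartsOfDisc n d δ f W` — the family `f : 𝒳 ⟶ S` with global class `W` is a `(ℚ(√-d), 2n, δ)`-Weil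
family**: every complex fibre `𝒳_s` carries a chart `e′ : A′.X ≅ 𝒳_s` by an abelian `2n`-fold with
`φ′ ≫ φ′ = -(d • 𝟙 A′)` taking `W|_{𝒳_s}` into the Weil plane `weilClassesOf A′ φ′ n d` (exactly the chart conjunct
of R∞var / R∞anc) AND a `K`-symmetrised hyperplane class `d·e″^*a″ + φ′^*e″^*a″` on `A′` of non-degenerate
discriminant class `δ`. In print: the fibres of the universal family over (a level cover of) the connected Shimura
component through one polarized triple all have the same invariant `(n, K, det H)` (`det H` is an isogeny invariant
of `(X, K, E)`, Lemma 5.2 (3), locally constant in polarized families). [cite: vanGeemen1994HodgeAV, Lemma 5.2 (3) and 5.5]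
[cite: Markman2025SecantWeil, §1.1 (preprint, unrefereed)] -/
def HasWeilChartsOfDisc (n d : ℕ) (δ : weilNormResidueGroup d) {𝒳 S : SchemeOver ℂ} (f : 𝒳 ⟶ S)
    (W : complexBetti 𝒳 (2 * n)) : Prop :=
  ∀ s : ComplexPoints S, ∃ (A' : AbelianVariety ℂ) (φ' : A' ⟶ A') (e' : A'.X ≅ fiberOver f s),
    A'.dim = 2 * n ∧ φ' ≫ φ' = -(d • 𝟙 A') ∧
      complexBetti.map e'.hom (2 * n) (complexBetti.map (fiberι f s) (2 * n) W) ∈ weilClassesOf A' φ' n d ∧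
      ∃ (e'' : ProjectiveEmbedding A'.X) (a'' : complexBetti (projectiveSpace e''.n ℂ) 2),
        IsRationalClass a'' ∧ a'' ≠ 0 ∧
          HasWeilDiscriminantNondeg A' φ' n d
            ((d : ℂ) • complexBetti.map e''.ι 2 a'' +
              complexBetti.map φ'.hom.hom.hom 2 (complexBetti.map e''.ι 2 a'')) δ

/-- A `(ℚ(√-d), 2n, δ)`-Weil family is in particular a `ℚ(√-d)`-Weil family in the sense of R∞var / R∞anc (forget
the polarizations). [cite: vanGeemen1994HodgeAV, Lemma 5.2] -/
theorem HasWeilChartsOfDisc.charts {n d : ℕ} {δ : weilNormResidueGroup d} {𝒳 S : SchemeOver ℂ} {f : 𝒳 ⟶ S}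
    {W : complexBetti 𝒳 (2 * n)} (h : HasWeilChartsOfDisc n d δ f W) :
    ∀ s : ComplexPoints S, ∃ (A' : AbelianVariety ℂ) (φ' : A' ⟶ A') (e' : A'.X ≅ fiberOver f s),
      A'.dim = 2 * n ∧ φ' ≫ φ' = -(d • 𝟙 A') ∧
        complexBetti.map e'.hom (2 * n) (complexBetti.map (fiberι f s) (2 * n) W) ∈ weilClassesOf A' φ' n d :=
  fun s => by
    obtain ⟨A', φ', e', h1, h2, h3, -⟩ := h s
    exact ⟨A', φ', e', h1, h2, h3⟩

/-- **`WeilVariationalHodgeComponent n d δ` — "VHC_instance ⟨Weil, ℚ(√-d), 2n, δ⟩" (typed missing input; a CASE of the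
summit).** VERBATIM the `(n, d)`-slice of R∞var `WeilTypeLadder.WeilVariationalHodgeQuadratic` with the chart hypothesis
strengthened to `HasWeilChartsOfDisc n d δ f W`: along a smooth projective `(ℚ(√-d), 2n, δ)`-Weil family over a
smooth irreducible quasi-projective base, a global class with fibrewise rational `(n,n)` restrictions in the Weil
planes that is algebraic on ONE fibre is algebraic on EVERY fibre. An instance of Grothendieck's variational Hodge
conjecture (Charles–Schnell Conj. 11.3.1); WEAKER than R∞var's slice (`…_of_weilVariationalHodgeQuadratic`, part
VII-B); known in print exactly where the component is. ON-PATH: `weilVariationalHodgeComponent_of_hodgeConjecture`.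
[cite: CharlesSchnell2014Notes, Conj. 11.3.1 (p. 477)] [cite: Markman2025SecantWeil, Thm. 1.5.1 and §2.4 (preprint, unrefereed)]
[status: open] -/
@[conjecture] def WeilVariationalHodgeComponent (n d : ℕ) (δ : weilNormResidueGroup d) : Prop :=
  ∀ ⦃𝒳 S : SchemeOver ℂ⦄ (f : 𝒳 ⟶ S), IsSmoothProjectiveFamily f (2 * n) →
    IsQuasiProjectiveOver 𝒳 → IsQuasiProjectiveOver S → IrreducibleSpace S.left →
    AlgebraicGeometry.Smooth S.hom →
    ∀ (W : complexBetti 𝒳 (2 * n)),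
      (∀ s : ComplexPoints S,
        IsRationalClass (complexBetti.map (fiberι f s) (2 * n) W) ∧
          IsOfHodgeType (2 * n) (fiberOver f s) (2 * n) n n (complexBetti.map (fiberι f s) (2 * n) W)) →
      HasWeilChartsOfDisc n d δ f W →
      (∃ s₀ : ComplexPoints S,
        complexBetti.map (fiberι f s₀) (2 * n) W ∈ algebraicClasses (fiberOver f s₀) n) →
      ∀ s : ComplexPoints S,
        complexBetti.map (fiberι f s) (2 * n) W ∈ algebraicClasses (fiberOver f s) n

/-- **`PointedWeilFamiliesComponent n d δ anchor` — family supply on the component with an ABSTRACT anchor (schema).**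
For `(A, φ, e, a)` as in `WeilClassesComponent n d δ` and a rational `(n,n)` Weil class `c ≠ 0`: a smooth projective
`(ℚ(√-d), 2n, δ)`-Weil family `f : 𝒳 ⟶ S` (`𝒳`, `S` quasi-projective, `S` smooth irreducible), points `s₁ s₀`, a
chart `ι : A.X ≅ 𝒳_{s₁}`, a global class `W` fibrewise rational of type `(n,n)` with `ι^*(W|_{𝒳_{s₁}}) = c`, and
`anchor 𝒳_{s₀} (W|_{𝒳_{s₀}})` at the marked fibre. Instances: CM chart (`CMPointedWeilFamiliesComponent`), algebraic
restriction (`AnchoredWeilFamiliesComponent`), divisor-generated CM chart (`DivisorGeneratedCMPointedWeilFamiliesComponent`).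
In print all three are ONE construction: the universal family over a level cover of the connected component of
Weil's moduli space of polarized abelian `2n`-folds of Weil type through `(A, φ, h)`, the flat Weil section lifted by
the global invariant cycle theorem, and a CM point (dense: Mumford 1969 §3) resp. the diagonal member `E_Kⁿ × E_Kⁿ`.
[cite: Deligne1982HodgeCycles, §4, proof of Thm. 4.8 (a)–(c) and §5] [cite: Mumford1969NoteShimura, §3]
[cite: vanGeemen1994HodgeAV, 5.3–5.5] -/
def PointedWeilFamiliesComponent (n d : ℕ) (δ : weilNormResidueGroup d)
    (anchor : (X : SchemeOver ℂ) → complexBetti X (2 * n) → Prop) : Prop :=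
  ∀ (A : AbelianVariety ℂ) (φ : A ⟶ A), A.dim = 2 * n → IsSmoothProjective (2 * n) A.X → φ ≫ φ = -(d • 𝟙 A) →
    ∀ (e : ProjectiveEmbedding A.X) (a : complexBetti (projectiveSpace e.n ℂ) 2), IsRationalClass a → a ≠ 0 →
      HasWeilDiscriminantNondeg A φ n d
        ((d : ℂ) • complexBetti.map e.ι 2 a + complexBetti.map φ.hom.hom.hom 2 (complexBetti.map e.ι 2 a)) δ →
      ∀ c : complexBetti A.X (2 * n), IsRationalClass c → IsOfHodgeType (2 * n) A.X (2 * n) n n c →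
        c ∈ weilClassesOf A φ n d → c ≠ 0 →
        ∃ (𝒳 S : SchemeOver ℂ) (f : 𝒳 ⟶ S) (s₁ s₀ : ComplexPoints S) (ι : A.X ≅ fiberOver f s₁)
            (W : complexBetti 𝒳 (2 * n)),
          IsSmoothProjectiveFamily f (2 * n) ∧ IsQuasiProjectiveOver 𝒳 ∧ IsQuasiProjectiveOver S ∧
          IrreducibleSpace S.left ∧ AlgebraicGeometry.Smooth S.hom ∧
          (∀ s : ComplexPoints S,
            IsRationalClass (complexBetti.map (fiberι f s) (2 * n) W) ∧
              IsOfHodgeType (2 * n) (fiberOver f s) (2 * n) n n (complexBetti.map (fiberι f s) (2 * n) W)) ∧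
          HasWeilChartsOfDisc n d δ f W ∧
          complexBetti.map ι.hom (2 * n) (complexBetti.map (fiberι f s₁) (2 * n) W) = c ∧
          anchor (fiberOver f s₀) (complexBetti.map (fiberι f s₀) (2 * n) W)

/-- The CM anchor: the marked fibre is presented by a CM abelian variety of dimension `2n` (`Milne1999.IsOfCMType`).
[cite: Mumford1969NoteShimura, §3] -/
def cmAnchor (n : ℕ) (X : SchemeOver ℂ) (_x : complexBetti X (2 * n)) : Prop :=
  ∃ A₀ : AbelianVariety ℂ, Nonempty (A₀.X ≅ X) ∧ A₀.dim = 2 * n ∧ IsOfCMType A₀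

/-- The algebraic anchor: the restricted class is algebraic on the marked fibre (R∞anc's last conjunct). [folklore] -/
def algebraicAnchor (n : ℕ) (X : SchemeOver ℂ) (x : complexBetti X (2 * n)) : Prop :=
  x ∈ algebraicClasses X n

/-- The divisor-generated CM anchor: a CM chart `A₀` of dimension `2n` all of whose rational `(n,n)` classes are
polynomials in divisor classes (`divisorClassesSpan`; in print the diagonal member `E_Kⁿ × E_Kⁿ`, `K` imaginary
quadratic: `Hdg = Div` for powers of a CM elliptic curve — Tate / Murasaki / Hazama; RING2-MAP §transport (vi-b)(c1)).
[cite: vanGeemen1994HodgeAV, 5.5] -/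
def divisorGeneratedCMAnchor (n : ℕ) (X : SchemeOver ℂ) (_x : complexBetti X (2 * n)) : Prop :=
  ∃ A₀ : AbelianVariety ℂ, Nonempty (A₀.X ≅ X) ∧ A₀.dim = 2 * n ∧ IsOfCMType A₀ ∧
    ∀ y : complexBetti A₀.X (2 * n), IsRationalClass y → IsOfHodgeType A₀.dim A₀.X (2 * n) n n y →
      y ∈ divisorClassesSpan A₀.X A₀.dim n

/-- **`CMPointedWeilFamiliesComponent n d δ` — CM-pointed `(ℚ(√-d), 2n, δ)`-Weil families (typed missing input; NOT a
Literature fact; NOT a case of HC, hence no on-path lemma).** `PointedWeilFamiliesComponent` with the CM anchor: the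
δ-indexed form of `Ring2Transport.CMPointedWeilFamiliesQuadratic`. In print: Weil 1977 / Deligne LNM 900 §4–5 moduli
of polarized abelian varieties of Weil type, one CM point per component (Mumford 1969 §3), `det H` constant on the
component (Lemma 5.2 (3)). OPEN as a formal statement (no moduli space of Weil type in `Literature/`).
[cite: Deligne1982HodgeCycles, §4, proof of Thm. 4.8 (a)–(c) and §5] [cite: Mumford1969NoteShimura, §3]
[cite: vanGeemen1994HodgeAV, Lemma 5.2 (3) and 5.5] [status: open] -/
@[conjecture] def CMPointedWeilFamiliesComponent (n d : ℕ) (δ : weilNormResidueGroup d) : Prop :=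
  PointedWeilFamiliesComponent n d δ (cmAnchor n)

/-- **`AnchoredWeilFamiliesComponent n d δ` — R∞anc of the component (typed missing input; a CASE of the summit).**
`PointedWeilFamiliesComponent` with the algebraic anchor: the δ-indexed form of
`WeilTypeLadder.AnchoredWeilFamiliesQuadratic` (Markman's anchor supply: product points with `K`-secant sheaves on the
SPLIT component, arXiv:2502.03415 §2.4; for `δ ≠ (-1)ⁿ` no anchor mechanism is in print beyond CM / diagonal members).
ON-PATH: `anchoredWeilFamiliesComponent_of_hodgeConjecture` (under HC the CONSTANT family `A.X ⟶ Spec ℂ`, anchored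
at `A` itself and charted on every fibre by `(A, φ, e, a)`, is a witness).
[cite: Markman2025SecantWeil, §1.2, §2.4 and Thm. 1.5.1 (preprint, unrefereed)] [status: open] -/
@[conjecture] def AnchoredWeilFamiliesComponent (n d : ℕ) (δ : weilNormResidueGroup d) : Prop :=
  PointedWeilFamiliesComponent n d δ (algebraicAnchor n)

/-- **`DivisorGeneratedCMPointedWeilFamiliesComponent n d δ` — CM-pointed `(ℚ(√-d), 2n, δ)`-Weil families whose CM
fibre is divisor-generated (typed missing input; the `HC_CM`-FREE family leaf).** The δ-indexed form of
`Ring2Transport.DivisorGeneratedCMPointedWeilFamiliesQuadratic`; met in print on EVERY component for imaginary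
quadratic `K` by the diagonal member (RING2-MAP §transport (vi-a)/(vi-b)(c1)), kept typed. Implies the CM-pointed leaf
(`cmPointedWeilFamiliesComponent_of_divisorGenerated`). [cite: vanGeemen1994HodgeAV, 5.5]
[cite: Deligne1982HodgeCycles, §4–5] [status: open] -/
@[conjecture] def DivisorGeneratedCMPointedWeilFamiliesComponent (n d : ℕ) (δ : weilNormResidueGroup d) : Prop :=
  PointedWeilFamiliesComponent n d δ (divisorGeneratedCMAnchor n)

/-! ### §2 The rows: anchor engine with abstract anchor, then `HC_CM`, `HC_CM`-free and anchored instances -/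

/-- A pointed leaf with a STRONGER anchor implies the pointed leaf with a weaker one. [folklore] -/
theorem PointedWeilFamiliesComponent.mono {n d : ℕ} {δ : weilNormResidueGroup d}
    {P Q : (X : SchemeOver ℂ) → complexBetti X (2 * n) → Prop} (hPQ : ∀ X x, P X x → Q X x)
    (hP : PointedWeilFamiliesComponent n d δ P) : PointedWeilFamiliesComponent n d δ Q := by
  intro A φ hAdim hX hφ e a haQ ha0 hδ c hcQ hcH hc hc0
  obtain ⟨𝒳, S, f, s₁, s₀, ι, W, hf, h𝒳, hS, hirrS, hsm, hW, hch, hread, hanch⟩ :=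
    hP A φ hAdim hX hφ e a haQ ha0 hδ c hcQ hcH hc hc0
  exact ⟨𝒳, S, f, s₁, s₀, ι, W, hf, h𝒳, hS, hirrS, hsm, hW, hch, hread, hPQ _ _ hanch⟩

/-- **ANCHOR ENGINE of the component (abstract anchor).** If the anchor predicate makes rational `(n,n)` classes
algebraic on the marked fibre, then pointed `(ℚ(√-d), 2n, δ)`-Weil families and the δ-restricted Weil-confined
variational Hodge statement give the class target of the component: take the family through `c ≠ 0`, the anchor makes
`W|_{𝒳_{s₀}}` algebraic, `WeilVariationalHodgeComponent` transports algebraicity to `𝒳_{s₁}`, read back along `ι`.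
[cite: Markman2025SecantWeil, Thm. 1.5.1 (strategy; preprint, unrefereed)] [cite: CharlesSchnell2014Notes, Conj. 11.3.1] -/
theorem weilClassesComponent_of_pointed_of_variational {n d : ℕ} {δ : weilNormResidueGroup d}
    {anchor : (X : SchemeOver ℂ) → complexBetti X (2 * n) → Prop}
    (hvalid : ∀ (X : SchemeOver ℂ) (x : complexBetti X (2 * n)), anchor X x → IsRationalClass x →
      IsOfHodgeType (2 * n) X (2 * n) n n x → x ∈ algebraicClasses X n)
    (hP : PointedWeilFamiliesComponent n d δ anchor) (hV : WeilVariationalHodgeComponent n d δ) :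
    WeilClassesComponent n d δ := by
  intro A φ hAdim hX hφ e a haQ ha0 hδ c hcQ hcH hc
  by_cases hc0 : c = 0
  · rw [hc0]; exact Submodule.zero_mem _
  obtain ⟨𝒳, S, f, s₁, s₀, ι, W, hf, h𝒳, hS, hirrS, hsm, hW, hch, hread, hanch⟩ :=
    hP A φ hAdim hX hφ e a haQ ha0 hδ c hcQ hcH hc hc0
  haveI := hirrS
  have hs₀ : complexBetti.map (fiberι f s₀) (2 * n) W ∈ algebraicClasses (fiberOver f s₀) n :=
    hvalid _ _ hanch (hW s₀).1 (hW s₀).2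
  have h1 : complexBetti.map (fiberι f s₁) (2 * n) W ∈ algebraicClasses (fiberOver f s₁) n :=
    hV f hf h𝒳 hS hirrS hsm W hW hch ⟨s₀, hs₀⟩ s₁
  rw [← hread]
  exact (mem_algebraicClasses_map_iff_of_iso ι).2 h1

/-- Under `HC_CM` the CM anchor is valid: a rational `(n,n)` class on a fibre presented by a CM abelian `2n`-fold is
algebraic (`Ring2Transport.mem_algebraicClasses_of_cmChart` — the ONLY place `HC_CM` is consumed in this file).
[cite: Milne1999, §7 p. 72] -/
theorem cmAnchor_valid_of_HC_CM (hCM : Theses.RankFourFaces.CMAbelianHodge) (n : ℕ) :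
    ∀ (X : SchemeOver ℂ) (x : complexBetti X (2 * n)), cmAnchor n X x → IsRationalClass x →
      IsOfHodgeType (2 * n) X (2 * n) n n x → x ∈ algebraicClasses X n := by
  rintro X x ⟨A₀, ⟨e₀⟩, hA₀dim, hA₀cm⟩ hxQ hxH
  exact mem_algebraicClasses_of_cmChart hCM A₀ e₀ hA₀dim hA₀cm hxQ hxH

/-- The divisor-generated CM anchor is valid WITHOUT `HC_CM`: transport `x` to the chart `A₀`, where it is a rational
`(n,n)` class, hence in `divisorClassesSpan`, hence algebraic by Lefschetz (1,1) and products
(`Ring2Transport.divisorClassesSpan_le_algebraicClasses_dim`), and transport back. [cite: vanGeemen1994HodgeAV, 2.4 and 5.5] -/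
theorem divisorGeneratedCMAnchor_valid (n : ℕ) :
    ∀ (X : SchemeOver ℂ) (x : complexBetti X (2 * n)), divisorGeneratedCMAnchor n X x → IsRationalClass x →
      IsOfHodgeType (2 * n) X (2 * n) n n x → x ∈ algebraicClasses X n := by
  rintro X x ⟨A₀, ⟨e₀⟩, hA₀dim, -, hdiv⟩ hxQ hxH
  have hx' : complexBetti.map e₀.hom (2 * n) x ∈ algebraicClasses A₀.X n := by
    refine divisorClassesSpan_le_algebraicClasses_dim A₀ n (hdiv _ ((isRationalClass_map_iff_of_iso e₀).2 hxQ) ?_)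
    rw [hA₀dim]
    exact (isOfHodgeType_map_iff_of_iso e₀).2 hxH
  exact (mem_algebraicClasses_map_iff_of_iso e₀).1 hx'

/-- The algebraic anchor is valid by definition. [folklore] -/
theorem algebraicAnchor_valid (n : ℕ) :
    ∀ (X : SchemeOver ℂ) (x : complexBetti X (2 * n)), algebraicAnchor n X x → IsRationalClass x →
      IsOfHodgeType (2 * n) X (2 * n) n n x → x ∈ algebraicClasses X n :=
  fun _ _ hx _ _ => hx

/-- **Row W1 — `HC_Weil_K_2n_disc_of_HC_CM`: the class target of the component `(ℚ(√-d), 2n, δ)` from `HC_CM`,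
CM-pointed δ-families and the δ-restricted Weil-confined variational Hodge statement.** CONDITIONAL on the three named
hypotheses; ON-PATH lemma of the target: `weilClassesComponent_of_hodgeConjecture`. HONEST COLUMN: for `K` imaginary
quadratic `HC_CM` is NOMINAL (row W1′ removes it); the content is `WeilVariationalHodgeComponent n d δ`, OPEN.
[cite: Markman2025SecantWeil, Thm. 1.5.1 (strategy; preprint, unrefereed)] [cite: Deligne1982HodgeCycles, proof of Thm. 4.8] -/
theorem weilClassesComponent_of_HC_CM (hCM : Theses.RankFourFaces.CMAbelianHodge) {n d : ℕ}
    {δ : weilNormResidueGroup d} (hP : CMPointedWeilFamiliesComponent n d δ)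
    (hV : WeilVariationalHodgeComponent n d δ) : WeilClassesComponent n d δ :=
  weilClassesComponent_of_pointed_of_variational (cmAnchor_valid_of_HC_CM hCM n) hP hV

/-- **Row W1′ — the same class target WITHOUT `HC_CM`**, from divisor-generated CM-pointed δ-families (met in print
on every component for imaginary quadratic `K`) and the δ-restricted variational statement.
[cite: vanGeemen1994HodgeAV, 5.5] [cite: CharlesSchnell2014Notes, Conj. 11.3.1] -/
theorem weilClassesComponent_of_divisorGeneratedCMPointed {n d : ℕ} {δ : weilNormResidueGroup d}
    (hP : DivisorGeneratedCMPointedWeilFamiliesComponent n d δ) (hV : WeilVariationalHodgeComponent n d δ) :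
    WeilClassesComponent n d δ :=
  weilClassesComponent_of_pointed_of_variational (divisorGeneratedCMAnchor_valid n) hP hV

/-- **Row W1″ — R∞anc(δ) ∧ R∞var(δ) ⟹ W(δ)** (Markman's two-step strategy, per component).
[cite: Markman2025SecantWeil, Thm. 1.5.1 (strategy; preprint, unrefereed)] -/
theorem weilClassesComponent_of_anchored_of_variational {n d : ℕ} {δ : weilNormResidueGroup d}
    (hA : AnchoredWeilFamiliesComponent n d δ) (hV : WeilVariationalHodgeComponent n d δ) :
    WeilClassesComponent n d δ :=
  weilClassesComponent_of_pointed_of_variational (algebraicAnchor_valid n) hA hV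

/-- A divisor-generated CM-pointed δ-family is a CM-pointed δ-family (forget the divisor clause). [folklore] -/
theorem cmPointedWeilFamiliesComponent_of_divisorGenerated {n d : ℕ} {δ : weilNormResidueGroup d}
    (hP : DivisorGeneratedCMPointedWeilFamiliesComponent n d δ) : CMPointedWeilFamiliesComponent n d δ := by
  intro A φ hAdim hX hφ e a haQ ha0 hδ c hcQ hcH hc hc0
  obtain ⟨𝒳, S, f, s₁, s₀, ι, W, hf, h𝒳, hS, hirrS, hsm, hW, hch, hread, A₀, he₀, hA₀dim, hA₀cm, -⟩ :=
    hP A φ hAdim hX hφ e a haQ ha0 hδ c hcQ hcH hc hc0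
  exact ⟨𝒳, S, f, s₁, s₀, ι, W, hf, h𝒳, hS, hirrS, hsm, hW, hch, hread, A₀, he₀, hA₀dim, hA₀cm⟩

/-- Under `HC_CM` a CM-pointed δ-family is an anchored δ-family. [cite: Deligne1982HodgeCycles, proof of Thm. 4.8 (a)–(c)] -/
theorem anchoredWeilFamiliesComponent_of_HC_CM_of_cmPointed (hCM : Theses.RankFourFaces.CMAbelianHodge) {n d : ℕ}
    {δ : weilNormResidueGroup d} (hP : CMPointedWeilFamiliesComponent n d δ) :
    AnchoredWeilFamiliesComponent n d δ := by
  intro A φ hAdim hX hφ e a haQ ha0 hδ c hcQ hcH hc hc0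
  obtain ⟨𝒳, S, f, s₁, s₀, ι, W, hf, h𝒳, hS, hirrS, hsm, hW, hch, hread, hanch⟩ :=
    hP A φ hAdim hX hφ e a haQ ha0 hδ c hcQ hcH hc hc0
  exact ⟨𝒳, S, f, s₁, s₀, ι, W, hf, h𝒳, hS, hirrS, hsm, hW, hch, hread,
    cmAnchor_valid_of_HC_CM hCM n _ _ hanch (hW s₀).1 (hW s₀).2⟩

/-- **Under HC the anchored δ-leaf holds**: the CONSTANT family `A.X ⟶ Spec ℂ` anchored at `A` itself, every fibre
charted by `(A, φ)` with the given polarizing pair `(e, a)` of discriminant `δ` (fibre inclusions are isomorphisms).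
So `AnchoredWeilFamiliesComponent` IS a case of the summit. [folklore] -/
theorem anchoredWeilFamiliesComponent_of_hodgeConjecture (h : _root_.HodgeConjecture) (n d : ℕ)
    (δ : weilNormResidueGroup d) : AnchoredWeilFamiliesComponent n d δ := by
  intro A φ hAdim hX hφ e a haQ ha0 hδ c hcQ hcH hc _
  have hfam : IsSmoothProjectiveFamily (toSpecOver A.X) (2 * n) := isSmoothProjectiveFamily_toSpecOver' hX
  let s : ComplexPoints (specOver ℂ ℂ) := 𝟙 (specOver ℂ ℂ)
  haveI : ∀ t : ComplexPoints (specOver ℂ ℂ), IsIso (fiberι (toSpecOver A.X) t) :=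
    fun t => isIso_fiberι_toSpecOver' (X := A.X) t
  let ι : A.X ≅ fiberOver (toSpecOver A.X) s := (asIso (fiberι (toSpecOver A.X) s)).symm
  have halg : c ∈ algebraicClasses A.X n := (h hX).2 n c hcQ hcH
  have hback : ∀ t : ComplexPoints (specOver ℂ ℂ),
      complexBetti.map (asIso (fiberι (toSpecOver A.X) t)).symm.hom (2 * n)
        (complexBetti.map (fiberι (toSpecOver A.X) t) (2 * n) c) = c := fun t => by
    change (complexBetti.map (asIso (fiberι (toSpecOver A.X) t)).hom (2 * n) ≫
      complexBetti.map (asIso (fiberι (toSpecOver A.X) t)).inv (2 * n)) c = c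
    rw [← complexBetti.map_comp, Iso.inv_hom_id, complexBetti.map_id]
    rfl
  refine ⟨A.X, specOver ℂ ℂ, toSpecOver A.X, s, s, ι, c, hfam,
    IsQuasiProjectiveOver.of_isProjectiveOver hX.isProjectiveOver, IsQuasiProjectiveOver.specOver,
    inferInstanceAs (IrreducibleSpace (PrimeSpectrum ℂ)), ?_, ?_, ?_, hback s, ?_⟩
  · haveI : IsIso (specOver ℂ ℂ).hom := by rw [specOver_hom_eq_id]; exact IsIso.id _
    infer_instance
  · intro t
    exact ⟨hcQ.pullback _, IsOfHodgeType.map_of_iso (asIso (fiberι (toSpecOver A.X) t)) hcH⟩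
  · intro t
    refine ⟨A, φ, (asIso (fiberι (toSpecOver A.X) t)).symm, hAdim, hφ, ?_, e, a, haQ, ha0, hδ⟩
    rw [hback t]
    exact hc
  · change complexBetti.map (fiberι (toSpecOver A.X) s) (2 * n) c ∈ algebraicClasses _ n
    exact (mem_algebraicClasses_map_iff_of_iso (asIso (fiberι (toSpecOver A.X) s))).2 halg

end Summit.HodgeConjecture.HodgeConjecture.Ring2.Hypotheses

end
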